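import Mathlib
import Summits.ValiantsHypothesis.ValiantsHypothesis.Theorems.NewtonUnitEquationsDissociatedUniformTotalsLawTrigFibres
import HarnessLib

/-!
# Crux `NewtonUnitEquations.DissociatedUniform` (stmt-ValiantsHypothesis-5905): ANGULAR CONES of a strictly convex counter-clockwise
# polygon — the angle sequence of the outward normals and its tiles

Memo `Cruxes/DissociatedUniform/NOTES-t1g8.md` §5(i) (the crossing-number argument for a co-oriented third polygon needs "the top vertex
of `C` goes around ONCE as the weight turns once").  For a strictly convex ccw polygon `c : ℤ/q → ℝ²` (`q ≥ 3`) this file constructs the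
ANGLES of its outward edge normals `nrm c k = perp Δ(k mod q)` as a sequence `coneAngle c t₀ : ℕ → ℝ` (start at a polar angle `t₀` of
`nrm c 0`, add the canonical relative angles) and proves:

* `nrm_eq_smul_udir` (every normal is a positive multiple of `udir (coneAngle k)`), `coneAngle_step` (steps = exterior angles, in
  `(0, π)`), `coneAngle_strictMono`, `coneAngle_add_q_sub` (the lap `ω(k+q) − ω k` is independent of `k`);
* `tile_dot` / **`wTop_udir_of_mem_tile`**: a direction with angle in the closed tile `[ω k, ω (k+1)]` has vertex `k + 1` as a weak top;
  **`eq_of_wTop_of_mem_openTile`**: in the open tile it is the ONLY weak top;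
* tools: polar form `exists_polar`, the canonical relative angle `relAngle` / `relAngle_spec` (`arccos`, in `(0,π)` for a left turn),
  `exists_rep_mem_Icc_of_combo` (a non-negative combination of two directions an angle `β < π` apart has its angle in the tile, mod `2π`),
  `udir_combo` (the converse identity).
The ONE-LAP theorem `ω (k + q) = ω k + 2π` and the integer cone-index lift of a weak top are in the companion `…TotalsLawOneLap`.
Honest label: plane geometry of convex polygons; nothing here bears on VP ≠ VNP.
[folklore: normal fan of a convex polygon]
-/

set_option linter.dupNamespace false -- `ValiantsHypothesis.ValiantsHypothesis` (summit = problem) in every name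

open scoped BigOperators

namespace Summit.ValiantsHypothesis.ValiantsHypothesis.Theorems.NewtonUnitEquationsDissociatedUniform

namespace TotalsLaw

open Matrix Real

section AngularCones

variable {q : ℕ}

/-! #### Directions and angles -/

/-- `⟨udir t, udir s⟩ = cos(s − t)`. [folklore] -/
theorem udir_dotProduct_udir (t s : ℝ) : udir t ⬝ᵥ udir s = Real.cos (s - t) := by
  simp only [udir, dotProduct_fin_two, Matrix.cons_val_zero, Matrix.cons_val_one, Real.cos_sub]; ring

/-- `det(udir t, udir s) = sin(s − t)`. [folklore] -/
theorem cross2_udir_udir (t s : ℝ) : cross2 (udir t) (udir s) = Real.sin (s - t) := by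
  simp only [udir, cross2, Matrix.cons_val_zero, Matrix.cons_val_one, Real.sin_sub]; ring

/-- `det` is linear in the second argument. [folklore] -/
theorem cross2_add_smul_right (u v w : Fin 2 → ℝ) (a b : ℝ) : cross2 u (a • v + b • w) = a * cross2 u v + b * cross2 u w := by
  simp [cross2]; ring

/-- `det` is linear in the first argument. [folklore] -/
theorem cross2_add_smul_left (u v w : Fin 2 → ℝ) (a b : ℝ) : cross2 (a • v + b • w) u = a * cross2 v u + b * cross2 w u := by
  simp [cross2]; ring

/-- **Polar form**: a non-zero plane vector is a positive multiple of a unit direction. [folklore] -/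
theorem exists_polar {v : Fin 2 → ℝ} (hv : v ≠ 0) : ∃ r : ℝ, 0 < r ∧ ∃ t : ℝ, v = r • udir t := by
  set w : ℂ := ⟨v 0, v 1⟩ with hw
  have hw0 : w ≠ 0 := by
    intro h
    apply hv
    have h0 : v 0 = 0 := by simpa [hw] using congrArg Complex.re h
    have h1 : v 1 = 0 := by simpa [hw] using congrArg Complex.im h
    ext i; fin_cases i <;> simp [h0, h1]
  refine ⟨‖w‖, norm_pos_iff.2 hw0, Complex.arg w, ?_⟩
  ext i; fin_cases i
  · simp only [udir, Fin.zero_eta, Fin.isValue, Pi.smul_apply, Matrix.cons_val_zero, smul_eq_mul]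
    rw [Complex.norm_mul_cos_arg]
  · simp only [udir, Fin.mk_one, Fin.isValue, Pi.smul_apply, Matrix.cons_val_one, Matrix.cons_val_zero, smul_eq_mul]
    rw [Complex.norm_mul_sin_arg]

/-- On `(−π, π]` a non-negative sine means a non-negative angle. [folklore] -/
theorem nonneg_of_sin_nonneg {x : ℝ} (hlo : -π < x) (h : 0 ≤ Real.sin x) : 0 ≤ x := by
  by_contra hx
  exact absurd h (not_le.2 (Real.sin_neg_of_neg_of_neg_pi_lt (not_le.1 hx) hlo))

/-- **A non-negative combination of two directions an angle `β ∈ (0,π)` apart points INTO the tile**: its angle lies in `[t₁, t₁ + β]`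
modulo `2π`. [folklore] -/
theorem exists_rep_mem_Icc_of_combo {t₁ β t r s s' : ℝ} (hβ0 : 0 < β) (hβπ : β < π) (hr : 0 < r) (hs : 0 ≤ s) (hs' : 0 ≤ s')
    (h : r • udir t = s • udir t₁ + s' • udir (t₁ + β)) : ∃ m : ℤ, t₁ ≤ t - m * (2 * π) ∧ t - m * (2 * π) ≤ t₁ + β := by
  have h2π : (0 : ℝ) < 2 * π := by positivity
  set τ := toIocMod h2π (t₁ - π) t with hτ
  have hτmem : τ ∈ Set.Ioc (t₁ - π) (t₁ - π + 2 * π) := toIocMod_mem_Ioc h2π (t₁ - π) t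
  obtain ⟨hτlo, hτhi⟩ := hτmem
  set m := toIocDiv h2π (t₁ - π) t with hm
  have hτt : τ = t - m * (2 * π) := by
    have := self_sub_toIocMod h2π (t₁ - π) t
    rw [zsmul_eq_mul] at this
    rw [hτ, hm]; linarith
  have hut : udir τ = udir t := by
    rw [hτt, show t - (m : ℝ) * (2 * π) = t + ((-m : ℤ) : ℝ) * (2 * π) by push_cast; ring, udir_add_int_mul]
  refine ⟨m, ?_, ?_⟩ <;> rw [← hτt]
  · -- det(udir t₁, r udir τ) = s' sin β ≥ 0
    have e := congrArg (fun v => cross2 (udir t₁) v) h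
    simp only [cross2_add_smul_right, cross2_udir_udir, sub_self, Real.sin_zero, mul_zero, zero_add, add_sub_cancel_left] at e
    rw [← hut, show cross2 (udir t₁) (r • udir τ) = r * Real.sin (τ - t₁) by
      rw [show r • udir τ = r • udir τ + (0 : ℝ) • udir τ by simp, cross2_add_smul_right, cross2_udir_udir]; ring] at e
    have hsin : 0 ≤ Real.sin (τ - t₁) := by
      have : 0 ≤ s' * Real.sin β := mul_nonneg hs' (Real.sin_pos_of_pos_of_lt_pi hβ0 hβπ).le
      nlinarith
    have := nonneg_of_sin_nonneg (x := τ - t₁) (by linarith) hsin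
    linarith
  · -- det(r udir τ, udir (t₁ + β)) = s sin β ≥ 0
    have e := congrArg (fun v => cross2 v (udir (t₁ + β))) h
    simp only [cross2_add_smul_left, cross2_udir_udir, sub_self, Real.sin_zero, mul_zero, add_zero, add_sub_cancel_left] at e
    rw [← hut, show cross2 (r • udir τ) (udir (t₁ + β)) = r * Real.sin (t₁ + β - τ) by
      rw [show r • udir τ = r • udir τ + (0 : ℝ) • udir τ by simp, cross2_add_smul_left, cross2_udir_udir]; ring] at e
    have hsin : 0 ≤ Real.sin (t₁ + β - τ) := by
      have : 0 ≤ s * Real.sin β := mul_nonneg hs (Real.sin_pos_of_pos_of_lt_pi hβ0 hβπ).le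
      nlinarith
    have := nonneg_of_sin_nonneg (x := t₁ + β - τ) (by linarith) hsin
    linarith

/-- The converse: directions in the tile are non-negative combinations (`sin β · udir(t₁ + s) = sin(β − s)·udir t₁ + sin s·udir(t₁ + β)`).
[folklore] -/
theorem udir_combo (t₁ β s : ℝ) :
    Real.sin β • udir (t₁ + s) = Real.sin (β - s) • udir t₁ + Real.sin s • udir (t₁ + β) := by
  ext i; fin_cases i <;> simp [udir, Real.sin_add, Real.cos_add, Real.sin_sub] <;> ring

/-- The CANONICAL RELATIVE ANGLE of two plane vectors (`arccos` of the normalised inner product, in `[0, π]`). -/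
noncomputable def relAngle (v w : Fin 2 → ℝ) : ℝ := Real.arccos ((v ⬝ᵥ w) / Real.sqrt ((v ⬝ᵥ v) * (w ⬝ᵥ w)))

/-- **Relative angle of a left turn.**  If `v = r·udir t` and `det(v, w) > 0` then `w = r'·udir(t + relAngle v w)` with
`relAngle v w ∈ (0, π)`. [folklore] -/
theorem relAngle_spec {v w : Fin 2 → ℝ} {r t : ℝ} (hr : 0 < r) (hv : v = r • udir t) (hvw : 0 < cross2 v w) :
    0 < relAngle v w ∧ relAngle v w < π ∧ ∃ r' : ℝ, 0 < r' ∧ w = r' • udir (t + relAngle v w) := by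
  have hw0 : w ≠ 0 := by
    rintro rfl; simp [cross2] at hvw
  obtain ⟨r', hr', tw, hw⟩ := exists_polar hw0
  have h2π : (0 : ℝ) < 2 * π := by positivity
  -- the representative of `tw - t` in `(-π, π]`
  set δ := toIocMod h2π (-π) (tw - t) with hδ
  have hδlo : -π < δ := by rw [hδ]; exact (toIocMod_mem_Ioc h2π (-π) (tw - t)).1
  have hδhi : δ ≤ -π + 2 * π := by rw [hδ]; exact (toIocMod_mem_Ioc h2π (-π) (tw - t)).2
  have hδrep : ∃ m : ℤ, δ = tw - t - m * (2 * π) := by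
    refine ⟨toIocDiv h2π (-π) (tw - t), ?_⟩
    have := self_sub_toIocMod h2π (-π) (tw - t)
    rw [zsmul_eq_mul] at this
    rw [hδ]; linarith
  obtain ⟨m, hm⟩ := hδrep
  have hcos : Real.cos δ = Real.cos (tw - t) := by
    rw [hm, show tw - t - (m : ℝ) * (2 * π) = (tw - t) + ((-m : ℤ) : ℝ) * (2 * π) by push_cast; ring, Real.cos_add_int_mul_two_pi]
  have hsin : Real.sin δ = Real.sin (tw - t) := by
    rw [hm, show tw - t - (m : ℝ) * (2 * π) = (tw - t) + ((-m : ℤ) : ℝ) * (2 * π) by push_cast; ring, Real.sin_add_int_mul_two_pi]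
  -- inner and outer products in polar form
  have hdot : v ⬝ᵥ w = r * r' * Real.cos (tw - t) := by
    rw [hv, hw, smul_dotProduct, dotProduct_smul, udir_dotProduct_udir, smul_eq_mul, smul_eq_mul]; ring
  have hvv : v ⬝ᵥ v = r ^ 2 := by
    rw [hv, smul_dotProduct, dotProduct_smul, udir_dotProduct_udir, sub_self, Real.cos_zero, smul_eq_mul, smul_eq_mul]; ring
  have hww : w ⬝ᵥ w = r' ^ 2 := by
    rw [hw, smul_dotProduct, dotProduct_smul, udir_dotProduct_udir, sub_self, Real.cos_zero, smul_eq_mul, smul_eq_mul]; ring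
  have hcr : cross2 v w = r * r' * Real.sin (tw - t) := by
    rw [hv, hw]
    have := cross2_add_smul_right (r • udir t) (udir tw) (udir tw) r' 0
    rw [zero_smul, add_zero, zero_mul, add_zero] at this
    rw [this]
    have := cross2_add_smul_left (udir tw) (udir t) (udir t) r 0
    rw [zero_smul, add_zero, zero_mul, add_zero] at this
    rw [this, cross2_udir_udir]; ring
  have hrel : relAngle v w = δ := by
    rw [relAngle, hdot, hvv, hww, show r ^ 2 * r' ^ 2 = (r * r') ^ 2 by ring, Real.sqrt_sq (by positivity),
      mul_div_cancel_left₀ _ (by positivity), ← hcos, Real.arccos_cos]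
    · -- 0 ≤ δ
      have hs : 0 ≤ Real.sin δ := by
        rw [hsin]; have := mul_pos hr hr'; nlinarith
      exact nonneg_of_sin_nonneg hδlo hs
    · linarith
  have hsinpos : 0 < Real.sin δ := by rw [hsin]; have := mul_pos hr hr'; nlinarith
  have hδ0 : 0 < δ := by
    rcases lt_or_eq_of_le (nonneg_of_sin_nonneg hδlo hsinpos.le) with h | h
    · exact h
    · rw [← h, Real.sin_zero] at hsinpos; exact absurd hsinpos (lt_irrefl _)
  have hδπ : δ < π := by
    rcases lt_or_eq_of_le (show δ ≤ π by linarith) with h | h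
    · exact h
    · rw [h, Real.sin_pi] at hsinpos; exact absurd hsinpos (lt_irrefl _)
  refine ⟨hrel ▸ hδ0, hrel ▸ hδπ, r', hr', ?_⟩
  rw [hrel, hm, show t + (tw - t - (m : ℝ) * (2 * π)) = tw + ((-m : ℤ) : ℝ) * (2 * π) by push_cast; ring, udir_add_int_mul]
  exact hw

/-! #### The angle sequence of the outward normals -/

/-- The outward normal of the edge `k (mod q)`, indexed by `k : ℕ`. -/
def nrm (c : ZMod q → (Fin 2 → ℝ)) (k : ℕ) : Fin 2 → ℝ := perp (edgeVec c (k : ZMod q))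

/-- The ANGLE SEQUENCE of the outward normals: start at an angle `t₀` of the normal of edge `0` and add the relative angles. -/
noncomputable def coneAngle (c : ZMod q → (Fin 2 → ℝ)) (t₀ : ℝ) : ℕ → ℝ
  | 0 => t₀
  | k + 1 => coneAngle c t₀ k + relAngle (nrm c k) (nrm c (k + 1))

/-- `det(perp u, perp v) = det(u, v)`. [folklore] -/
theorem cross2_perp_perp (u v : Fin 2 → ℝ) : cross2 (perp u) (perp v) = cross2 u v := by
  simp [cross2, perp]; ring

/-- Consecutive normals turn left. [folklore] -/
theorem cross2_nrm_pos {c : ZMod q → (Fin 2 → ℝ)} (hc : StrictlyConvexCcw c) (hq : 3 ≤ q) (k : ℕ) :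
    0 < cross2 (nrm c k) (nrm c (k + 1)) := by
  rw [nrm, nrm, cross2_perp_perp]
  have := cross2_edgeVec_pos hc hq ((k + 1 : ℕ) : ZMod q)
  rwa [show ((k + 1 : ℕ) : ZMod q) - 1 = (k : ZMod q) by push_cast; ring] at this

/-- The normals are `q`-periodic in the index. [folklore] -/
theorem nrm_add_q (c : ZMod q → (Fin 2 → ℝ)) (k : ℕ) : nrm c (k + q) = nrm c k := by
  simp [nrm]

/-- **Polar form of all the normals along the angle sequence.** [folklore] -/
theorem nrm_eq_smul_udir {c : ZMod q → (Fin 2 → ℝ)} (hc : StrictlyConvexCcw c) (hq : 3 ≤ q) {t₀ r₀ : ℝ} (hr₀ : 0 < r₀)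
    (h0 : nrm c 0 = r₀ • udir t₀) (k : ℕ) : ∃ r : ℝ, 0 < r ∧ nrm c k = r • udir (coneAngle c t₀ k) := by
  induction k with
  | zero => exact ⟨r₀, hr₀, h0⟩
  | succ k ih =>
    obtain ⟨r, hr, hk⟩ := ih
    obtain ⟨-, -, r', hr', h'⟩ := relAngle_spec hr hk (cross2_nrm_pos hc hq k)
    exact ⟨r', hr', h'⟩

/-- The steps of the angle sequence are the exterior angles, in `(0, π)`. [folklore] -/
theorem coneAngle_step {c : ZMod q → (Fin 2 → ℝ)} (hc : StrictlyConvexCcw c) (hq : 3 ≤ q) {t₀ r₀ : ℝ} (hr₀ : 0 < r₀)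
    (h0 : nrm c 0 = r₀ • udir t₀) (k : ℕ) :
    coneAngle c t₀ k < coneAngle c t₀ (k + 1) ∧ coneAngle c t₀ (k + 1) < coneAngle c t₀ k + π := by
  obtain ⟨r, hr, hk⟩ := nrm_eq_smul_udir hc hq hr₀ h0 k
  obtain ⟨h1, h2, -⟩ := relAngle_spec hr hk (cross2_nrm_pos hc hq k)
  simp only [coneAngle]
  exact ⟨by linarith, by linarith⟩

/-- The angle sequence is strictly increasing. [folklore] -/
theorem coneAngle_strictMono {c : ZMod q → (Fin 2 → ℝ)} (hc : StrictlyConvexCcw c) (hq : 3 ≤ q) {t₀ r₀ : ℝ} (hr₀ : 0 < r₀)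
    (h0 : nrm c 0 = r₀ • udir t₀) : StrictMono (coneAngle c t₀) :=
  strictMono_nat_of_lt_succ fun k => (coneAngle_step hc hq hr₀ h0 k).1

/-- The lap `ω (k + q) − ω k` does not depend on `k` (the relative angles are `q`-periodic). [folklore] -/
theorem coneAngle_add_q_sub (c : ZMod q → (Fin 2 → ℝ)) (t₀ : ℝ) (k : ℕ) :
    coneAngle c t₀ (k + q) - coneAngle c t₀ k = coneAngle c t₀ q - coneAngle c t₀ 0 := by
  induction k with
  | zero => simp
  | succ k ih =>
    rw [show k + 1 + q = (k + q) + 1 by ring]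
    simp only [coneAngle] at ih ⊢
    rw [show k + q + 1 = (k + 1) + q by ring, nrm_add_q, nrm_add_q]
    linarith

/-! #### Tiles and tops -/

/-- Unit directions are non-zero. [folklore] -/
theorem udir_ne_zero (t : ℝ) : udir t ≠ 0 := by
  intro h
  have := congrArg (fun v => v ⬝ᵥ udir t) h
  simp only [udir_dotProduct_udir, sub_self, Real.cos_zero, zero_dotProduct] at this
  exact one_ne_zero this

/-- **The tile inequalities.**  For a direction with angle `t ∈ [ω k, ω (k+1)]`: `⟨udir t, Δ k⟩ ≥ 0` (strictly if `t > ω k`) and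
`⟨udir t, Δ (k+1)⟩ ≤ 0` (strictly if `t < ω (k+1)`) — the direction lies in the normal cone of the vertex `k + 1`, in its interior for
interior angles. [folklore] -/
theorem tile_dot {c : ZMod q → (Fin 2 → ℝ)} (hc : StrictlyConvexCcw c) (hq : 3 ≤ q) {t₀ r₀ : ℝ} (hr₀ : 0 < r₀)
    (h0 : nrm c 0 = r₀ • udir t₀) (k : ℕ) {t : ℝ} (h1 : coneAngle c t₀ k ≤ t) (h2 : t ≤ coneAngle c t₀ (k + 1)) :
    (0 ≤ udir t ⬝ᵥ edgeVec c (k : ZMod q) ∧ (coneAngle c t₀ k < t → 0 < udir t ⬝ᵥ edgeVec c (k : ZMod q))) ∧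
    (udir t ⬝ᵥ edgeVec c ((k : ZMod q) + 1) ≤ 0 ∧ (t < coneAngle c t₀ (k + 1) → udir t ⬝ᵥ edgeVec c ((k : ZMod q) + 1) < 0)) := by
  obtain ⟨r, hr, hk⟩ := nrm_eq_smul_udir hc hq hr₀ h0 k
  obtain ⟨hβ0, hβπ, r', hr', hk1⟩ := relAngle_spec hr hk (cross2_nrm_pos hc hq k)
  set β := relAngle (nrm c k) (nrm c (k + 1)) with hβ
  set s := t - coneAngle c t₀ k with hs
  have hω1 : coneAngle c t₀ (k + 1) = coneAngle c t₀ k + β := rfl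
  have hs0 : 0 ≤ s := by rw [hs]; linarith
  have hsβ : s ≤ β := by rw [hs]; linarith
  have hcombo := udir_combo (coneAngle c t₀ k) β s
  rw [show coneAngle c t₀ k + s = t by rw [hs]; ring] at hcombo
  have hsinβ : 0 < Real.sin β := Real.sin_pos_of_pos_of_lt_pi hβ0 hβπ
  have ed : ∀ d : Fin 2 → ℝ, Real.sin β * (udir t ⬝ᵥ d) =
      Real.sin (β - s) * (udir (coneAngle c t₀ k) ⬝ᵥ d) + Real.sin s * (udir (coneAngle c t₀ k + β) ⬝ᵥ d) := by
    intro d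
    have := congrArg (fun v => v ⬝ᵥ d) hcombo
    simpa only [smul_dotProduct, add_dotProduct, smul_eq_mul] using this
  have hu0 : udir (coneAngle c t₀ k) = r⁻¹ • nrm c k := by
    rw [hk, smul_smul, inv_mul_cancel₀ hr.ne', one_smul]
  have hu1 : udir (coneAngle c t₀ k + β) = r'⁻¹ • nrm c (k + 1) := by
    rw [hk1, smul_smul, inv_mul_cancel₀ hr'.ne', one_smul]
  have hss : 0 ≤ Real.sin s := Real.sin_nonneg_of_nonneg_of_le_pi hs0 (by linarith)
  have hsβs : 0 ≤ Real.sin (β - s) := Real.sin_nonneg_of_nonneg_of_le_pi (by linarith) (by linarith)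
  have hΔ := cross2_nrm_pos hc hq k
  rw [nrm, nrm, cross2_perp_perp, Nat.cast_succ] at hΔ
  -- the two inner products
  have e1 : Real.sin β * (udir t ⬝ᵥ edgeVec c (k : ZMod q)) =
      Real.sin s * (r'⁻¹ * cross2 (edgeVec c (k : ZMod q)) (edgeVec c ((k : ZMod q) + 1))) := by
    have e := ed (edgeVec c (k : ZMod q))
    rw [hu0, hu1, smul_dotProduct, smul_dotProduct, nrm, nrm, perp_dotProduct_self, perp_dotProduct, Nat.cast_succ,
      smul_eq_mul, smul_eq_mul] at e
    simpa only [mul_zero, zero_add] using e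
  have e2 : Real.sin β * (udir t ⬝ᵥ edgeVec c ((k : ZMod q) + 1)) =
      -(Real.sin (β - s) * (r⁻¹ * cross2 (edgeVec c (k : ZMod q)) (edgeVec c ((k : ZMod q) + 1)))) := by
    have e := ed (edgeVec c ((k : ZMod q) + 1))
    rw [hu0, hu1, smul_dotProduct, smul_dotProduct, nrm, nrm, Nat.cast_succ, perp_dotProduct_self, perp_dotProduct,
      smul_eq_mul, smul_eq_mul] at e
    simp only [mul_zero, add_zero] at e
    rw [cross2_swap] at e
    linarith
  have hA : 0 ≤ r'⁻¹ * cross2 (edgeVec c (k : ZMod q)) (edgeVec c ((k : ZMod q) + 1)) :=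
    mul_nonneg (inv_nonneg.2 hr'.le) hΔ.le
  have hA' : 0 < r'⁻¹ * cross2 (edgeVec c (k : ZMod q)) (edgeVec c ((k : ZMod q) + 1)) :=
    mul_pos (inv_pos.2 hr') hΔ
  have hB : 0 ≤ r⁻¹ * cross2 (edgeVec c (k : ZMod q)) (edgeVec c ((k : ZMod q) + 1)) :=
    mul_nonneg (inv_nonneg.2 hr.le) hΔ.le
  have hB' : 0 < r⁻¹ * cross2 (edgeVec c (k : ZMod q)) (edgeVec c ((k : ZMod q) + 1)) :=
    mul_pos (inv_pos.2 hr) hΔ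
  refine ⟨⟨?_, fun hlt => ?_⟩, ⟨?_, fun hlt => ?_⟩⟩
  · have : 0 ≤ Real.sin s * (r'⁻¹ * cross2 (edgeVec c (k : ZMod q)) (edgeVec c ((k : ZMod q) + 1))) := mul_nonneg hss hA
    nlinarith
  · have hspos : 0 < Real.sin s := Real.sin_pos_of_pos_of_lt_pi (by rw [hs]; linarith) (by linarith)
    have : 0 < Real.sin s * (r'⁻¹ * cross2 (edgeVec c (k : ZMod q)) (edgeVec c ((k : ZMod q) + 1))) := mul_pos hspos hA'
    nlinarith
  · have : 0 ≤ Real.sin (β - s) * (r⁻¹ * cross2 (edgeVec c (k : ZMod q)) (edgeVec c ((k : ZMod q) + 1))) := mul_nonneg hsβs hB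
    nlinarith
  · have hspos : 0 < Real.sin (β - s) := Real.sin_pos_of_pos_of_lt_pi (by rw [hs]; linarith) (by linarith)
    have : 0 < Real.sin (β - s) * (r⁻¹ * cross2 (edgeVec c (k : ZMod q)) (edgeVec c ((k : ZMod q) + 1))) := mul_pos hspos hB'
    nlinarith

/-- **Closed tile ⇒ weak top**: a direction with angle in `[ω k, ω (k+1)]` has the vertex `k + 1` as a weak top. [folklore] -/
theorem wTop_udir_of_mem_tile {c : ZMod q → (Fin 2 → ℝ)} (hc : StrictlyConvexCcw c) (hq : 3 ≤ q) {t₀ r₀ : ℝ} (hr₀ : 0 < r₀)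
    (h0 : nrm c 0 = r₀ • udir t₀) (k : ℕ) {t : ℝ} (h1 : coneAngle c t₀ k ≤ t) (h2 : t ≤ coneAngle c t₀ (k + 1)) :
    WTop c (udir t) ((k + 1 : ℕ) : ZMod q) := by
  obtain ⟨⟨ha, -⟩, ⟨hb, -⟩⟩ := tile_dot hc hq hr₀ h0 k h1 h2
  rw [wTop_iff_local hc hq (udir_ne_zero t), show ((k + 1 : ℕ) : ZMod q) - 1 = (k : ZMod q) by push_cast; ring]
  push_cast
  exact ⟨ha, hb⟩

/-- **Open tile ⇒ unique weak top**: for `t ∈ (ω k, ω (k+1))` the vertex `k + 1` is the ONLY weak top at `udir t`. [folklore] -/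
theorem eq_of_wTop_of_mem_openTile {c : ZMod q → (Fin 2 → ℝ)} (hc : StrictlyConvexCcw c) (hq : 3 ≤ q) {t₀ r₀ : ℝ}
    (hr₀ : 0 < r₀) (h0 : nrm c 0 = r₀ • udir t₀) (k : ℕ) {t : ℝ} (h1 : coneAngle c t₀ k < t)
    (h2 : t < coneAngle c t₀ (k + 1)) {w : ZMod q} (hw : WTop c (udir t) w) : w = ((k + 1 : ℕ) : ZMod q) := by
  obtain ⟨⟨-, ha⟩, ⟨-, hb⟩⟩ := tile_dot hc hq hr₀ h0 k h1.le h2.le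
  have hv := wTop_udir_of_mem_tile hc hq hr₀ h0 k h1.le h2.le
  rcases (sharpTops_of_strictlyConvexCcw hc hq (udir t) (udir_ne_zero t)).1 _ _ hv hw with h | h | h
  · exact h
  · -- `w = k + 2` would need `⟨udir t, Δ (k+1)⟩ ≥ 0`
    exfalso
    have := hw ((k + 1 : ℕ) : ZMod q)
    rw [h] at this
    have e : udir t ⬝ᵥ edgeVec c ((k : ZMod q) + 1) = udir t ⬝ᵥ c (((k + 1 : ℕ) : ZMod q) + 1) - udir t ⬝ᵥ c ((k + 1 : ℕ) : ZMod q) := by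
      rw [edgeVec, dotProduct_sub]; push_cast; ring_nf
    have := hb h2
    linarith
  · -- `w = k` would need `⟨udir t, Δ k⟩ ≤ 0`
    exfalso
    have hwk : w = (k : ZMod q) := by
      have := h; push_cast at this; linear_combination -this
    have := hw ((k + 1 : ℕ) : ZMod q)
    rw [hwk] at this
    have e : udir t ⬝ᵥ edgeVec c (k : ZMod q) = udir t ⬝ᵥ c ((k + 1 : ℕ) : ZMod q) - udir t ⬝ᵥ c (k : ZMod q) := by
      rw [edgeVec, dotProduct_sub]; push_cast; ring_nf
    have := ha h1
    linarith

end AngularCones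

end TotalsLaw

end Summit.ValiantsHypothesis.ValiantsHypothesis.Theorems.NewtonUnitEquationsDissociatedUniform
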